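import Summits.CriticalPhenomena.CardyFormulaZ2.Theses.CardyRetileGlue

/-!
# Birth skeleton of the crux `WindowTransport3`
(item `stmt-CriticalPhenomena-7031`, route `route-CriticalPhenomena-CardyRetileGlue`, sub-problem
`CardyFormulaZ2`; BC3 skeleton registered by the skeleton registrar, 2026-08-17)

The crux `WindowTransport3`: for every bi-periodic isoradial graph `G` of Grimmett–Manolescu's
class (preconnected, isoradial rhombic tiling, square-grid property, BAP(ε)) whose rhombus-side
directions lie on three lines, and every conformal rectangle `R = (Ω; a, b, c, d)`,
`P_G[crude crossing of R at mesh δ] − P_ℤ²[crude crossing of R at mesh δ] → 0` as `δ → 0⁺`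
(crude event `embDomainCrossing`: an open path with all rescaled vertices in `Ω = R.carrier`, from
the `2δ`-neighbourhood of `A = R.arc 0` to that of `B = R.arc 2`; canonical weights
`emb.isoradialPercolation`; `ℤ²` = `bondPercolation (zdGraph 2) half` drawn by
`squareLatticeEmbedding.z`).

## The line `birth` — the route's own two-layer plan for this crux, typed

Route header, TWO-LAYER PLAN: "WindowTransport3 ⇐ (a) BlockTilingOfWindows, (b) SectorwiseZ2,
(c) glue = ExactRetiling + boundary fuzz"; support item `TransportOfGluing`
(stmt-CriticalPhenomena-11313): `GluingComparison → IsoRectCrossingCoupling → IsoradialBoxCrossing →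
ExactRetiling → WindowTransport3`. The line is an INTERPOLATION through an intermediate
mesh-indexed model — the *block family* `B = (B_δ)_δ`, the window `Ω` retiled exactly by frozen
two-direction ("rectangular-lattice") blocks — and the composition is the telescoping
`P_G − P_ℤ² = (P_G − P_B) + (P_B − P_ℤ²)`:

* `stub_windowRetiling` — RETILE THE WINDOW EXACTLY (cards zero-error-star-triangle-gluing M1/M2,
  items `ExactRetiling`, `TrackCutCells`, `RowLawIdentity`; Schramm–Smirnov App. A boundary fuzz;
  Grimmett–Manolescu RSW / arm comparability for the a-priori bounds): for every `G` as in the crux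
  and every `R` there is a mesh-indexed family `B_δ` of preconnected isoradial edge-to-edge rhombic
  tilings with THREE FIXED side directions `±u₀, ±u₁, ±u₂`, which on the window `Ω`, off a union of
  seam segments `S` that is locally finite in `Ω` (the seams may accumulate at `∂Ω` only) and off a
  collar of width `ϖ(δ) → 0` around `∂Ω ∪ S`, is *sectorwise rectangular* (rhombi that touch are translates of one another, so every bulk piece is a rotated
  patch of an isoradial rectangular lattice `𝕃(α)` at mesh `δ`), which satisfies Schramm–Smirnov's
  Assumptions 1.1 uniformly in the mesh (box crossings at aspect ratio 2; alternating four-arm bound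
  `≤ (m/n)·Δ(mδ, nδ)`, `Δ(r, ρ) → 0` as `r → 0`, in the two-disjoint-clusters form of
  arXiv:2008.01606 — verbatim the hypotheses of the route crux `GluingComparison`), and whose crude
  crossing probability of `R` differs from `G`'s by `o(1)`. Intended witness: `B_δ = G` outside the
  lattice polygon `K_δ ⊇ Ω/δ`, frozen blocks of track-cut cells inside (ExactRetiling makes the
  `K_δ`-restricted boundary-to-boundary connection laws IDENTICAL; the passage to the crude event is
  RSW boundary fuzz on both sides).
* `stub_blockCoupling` — DKKMO, SECTORWISE (item `IsoRectCrossingCoupling` = arXiv:2012.11672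
  Thm 1.7 + Thm 1.2 at `q = 1`, read on crossing indicators, assembled piece by piece): such a
  sectorwise-rectangular family is coupled, mesh by mesh, to bond-`ℤ²` at `1/2` with the exact
  marginals, so that for every conformal rectangle `R'` compactly inside `Ω ∖ seams` the two crude
  crossing indicators agree with probability `→ 1`.
* `stub_windowGluing` — TWO-MODEL GLUING AT A WINDOW (route crux `GluingComparison` =
  Schramm–Smirnov's Question 2 "constructive gluing", arXiv:1101.5820, here LOCALISED to one window
  and with model 2 = bond-`ℤ²`; plus SS App. A / Lemma 6.1 boundary fuzz at `∂Ω`): a family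
  satisfying SS Assumptions 1.1 that is so coupled to `ℤ²` on `Ω` off a locally finite family of seam
  segments has `P_B[crude crossing of R] − P_ℤ²[crude crossing of R] → 0` for the window `R` itself.

Why the interface is RSW/arms and not "`B_δ ∈ 𝒢(ε, I)` uniformly": a frozen two-direction block of
macroscopic size contains no track of the third direction, so the printed square-grid property
SGP(I) fails for every fixed `I` along `δ → 0` although RSW holds inside the block (it is `𝕃(α)`);
and why the gluing is localised to the window: a full-plane three-direction tiling that is
sectorwise rectangular off a BOUNDED seam set is a single lattice (frozen height function), so the
full-plane hypothesis of `GluingComparison` (agreement on all quads avoiding finitely many bounded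
segments) cannot be met by a retiled window whose outside is `G` — the honest form of (b)+(c) is the
window-local comparison stated here (recorded for the tenure planner in `Lines/birth.md`).

`WindowTransport3_of` (sorry-free; hypotheses = the three stub statements `Sig.stub_*`, conclusion
literally the route decl `CardyRetileGlue.WindowTransport3`): fix `G`, its hypotheses and `R`; take
the block family of `stub_windowRetiling`; `stub_blockCoupling` couples it to `ℤ²` on the window;
`stub_windowGluing` gives `P_B − P_ℤ² → 0`; add to `P_G − P_B → 0` (`Tendsto.add`,
`sub_add_sub_cancel`). `WindowTransport3_of_stubs` feeds the three `stub_*` BY NAME.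

Disproof used: none on file for this crux (no `Cruxes/WindowTransport3/` directory before this
skeleton: no `Disproof.lean`, no `Negative/` lemmas, 2026-08-17). Negatives index of the summit (11
entries as of 2026-08-17, per the sibling registrar of stmt-4665): the nearest,
`CardyGluingRDE.JunctionShadowing` (stmt-8581: trivial one-vertex paths through the NON-STRICT
discrete arcs of G02's `discreteCrossing`), concerns `discreteCrossing`, not the crude event
`embDomainCrossing` used throughout here; all statements of this line are `δ → 0⁺` limits, for which
a vertex within `2δ` of both arcs (`dist(A, B) > 0`) eventually does not exist.
-/

namespace Summit.CriticalPhenomena.CardyFormulaZ2.Cruxes.WindowTransport3.Birth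

open Filter Topology MeasureTheory
open Literature.Probability.LatticeModels Literature.Probability.Percolation
open Literature.Probability.RandomPlanarGeometry (ConformalRectangle)

/-! ### Vocabulary of the line
All constants are tree / Mathlib declarations: `RhombicEmbedding` with `z`, `c`, `leftFace`,
`rightFace`, `rhombus`, `IsIsoradial`, `IsRhombicTiling`, `HasSquareGridProperty`,
`HasBoundedAngles`, `isoradialPercolation`, `BoxCrossingBounds`, `squareLatticeEmbedding`, `zdGraph`,
`Site`, `Complex.boxNorm` (`Literature.Probability.LatticeModels`); `BondConfig`, `openConnIn`,
`embDomainCrossing`, `bondPercolation`, `half` (`Literature.Probability.Percolation`);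
`ConformalRectangle` with `carrier`, `arc` (`Literature.Probability.RandomPlanarGeometry`); Mathlib's
`segment`, `Metric.infDist`, `Measure.map`, `Measure.real`, `𝓝[>]`. -/

section Vocabulary

variable {V F : Type} {G : SimpleGraph V}

/-- The seam set `⋃ S` of a family of segments `S` (as in the route crux `GluingComparison`, but the
family may be infinite: for a general Jordan window the block seams have to accumulate at `∂Ω`). -/
def seams (S : Set (ℂ × ℂ)) : Set ℂ := ⋃ p ∈ S, segment ℝ p.1 p.2

/-- LOCAL FINITENESS of the seams in the window: every compact subset of `Ω` meets only finitely
many seam segments (so a conformal rectangle compactly inside `Ω ∖ ⋃ S` is at positive distance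
from the seams, and Schramm–Smirnov gluing inside any shrunken window is a FINITE gluing). -/
def SeamsLocallyFinite (Ω : Set ℂ) (S : Set (ℂ × ℂ)) : Prop :=
  ∀ K ⊆ Ω, IsCompact K → {p ∈ S | (segment ℝ p.1 p.2 ∩ K).Nonempty}.Finite

/-- The four corners of the rhombus of the dart `d = (x → y)`: `z x`, `c (leftFace d)`, `z y`,
`c (rightFace d)` (the corner set of `emb.rhombus ⟨d.edge, _⟩` under `IsIsoradial`). -/
def dartCorners (emb : RhombicEmbedding G F) (d : G.Dart) : Set ℂ :=
  {emb.z d.fst, emb.c (emb.leftFace d), emb.z d.snd, emb.c (emb.rightFace d)}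

/-- EDGE-TO-EDGE: a corner of a rhombus lying in another rhombus is a corner of it (no corner in
the relative interior of a foreign side — excludes dislocation lines / brick patterns, which the
dart-wise predicates `IsIsoradial`, `IsRhombicTiling` do not see). -/
def IsEdgeToEdge (emb : RhombicEmbedding G F) : Prop :=
  ∀ d d' : G.Dart, ∀ p ∈ dartCorners emb d, p ∈ emb.rhombus ⟨d'.edge, d'.edge_mem⟩ →
    p ∈ dartCorners emb d'

/-- The side pair of the rhombus of the dart `d = (x → y)`, up to sign: the two sides at the
left face centre `f`, `f − z x` and `f − z y`, and their negatives. Two rhombi with equal side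
pairs are translates of one another. -/
def sidePair (emb : RhombicEmbedding G F) (d : G.Dart) : Set ℂ :=
  {emb.c (emb.leftFace d) - emb.z d.fst, -(emb.c (emb.leftFace d) - emb.z d.fst),
    emb.c (emb.leftFace d) - emb.z d.snd, -(emb.c (emb.leftFace d) - emb.z d.snd)}

/-- THREE FIXED DIRECTIONS: both sides of every rhombus at its left face centre are among
`±u 0, ±u 1, ±u 2` (the crux's clause "rhombus-edge directions lie on three lines", written for
both sides and with the direction vectors `u` as a parameter, so that they can be held fixed
along a mesh-indexed family). -/
def HasDirections (u : Fin 3 → ℂ) (emb : RhombicEmbedding G F) : Prop :=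
  ∀ d : G.Dart,
    (∃ i : Fin 3, emb.c (emb.leftFace d) - emb.z d.fst = u i ∨
        emb.c (emb.leftFace d) - emb.z d.fst = -(u i)) ∧
      (∃ j : Fin 3, emb.c (emb.leftFace d) - emb.z d.snd = u j ∨
        emb.c (emb.leftFace d) - emb.z d.snd = -(u j))

/-- BULK RHOMBUS of the window `Ω` at mesh `δ`: the rescaled rhombus `δ · rhombus d` keeps
distance `≥ ϖ δ` from the seams `⋃ S` and from the complement of `Ω` (so, when `ϖ δ > 0`, it lies
inside `Ω`, off the seams and off a collar of width `ϖ δ` around `∂Ω ∪ ⋃ S`). -/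
def IsBulk (Ω : Set ℂ) (S : Set (ℂ × ℂ)) (ϖ : ℝ → ℝ) (emb : RhombicEmbedding G F) (δ : ℝ)
    (d : G.Dart) : Prop :=
  ∀ w ∈ emb.rhombus ⟨d.edge, d.edge_mem⟩, ϖ δ ≤ Metric.infDist ((δ : ℂ) * w) (seams S ∪ Ωᶜ)

/-- The alternating four-arm event around `w` between box radii `m` and `n` (lattice units) in the
two-disjoint-open-clusters form of arXiv:2008.01606, verbatim the event of the route crux
`GluingComparison` (Schramm–Smirnov 2011, Assumptions 1.1(2)). -/
def twoClustersCross (emb : RhombicEmbedding G F) (w : ℂ) (m n : ℕ) : Set (BondConfig V) :=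
  {ω | ∃ x₁ x₂ y₁ y₂ : V, (emb.z x₁ - w).boxNorm ≤ m + 2 ∧ (emb.z x₂ - w).boxNorm ≤ m + 2 ∧
      (n : ℝ) ≤ (emb.z y₁ - w).boxNorm ∧ (n : ℝ) ≤ (emb.z y₂ - w).boxNorm ∧
      ω ∈ openConnIn {v | (m : ℝ) ≤ (emb.z v - w).boxNorm ∧ (emb.z v - w).boxNorm ≤ n + 2} x₁ y₁ ∧
      ω ∈ openConnIn {v | (m : ℝ) ≤ (emb.z v - w).boxNorm ∧ (emb.z v - w).boxNorm ≤ n + 2} x₂ y₂ ∧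
      ω ∉ openConnIn {v | (m : ℝ) ≤ (emb.z v - w).boxNorm ∧ (emb.z v - w).boxNorm ≤ n + 2} x₁ x₂}

end Vocabulary

section Families

variable {V' F' : Type}

/-- REGULARITY of a mesh-indexed family of rhombic tilings: every member is a preconnected,
isoradial, edge-to-edge rhombic tiling of the plane (Grimmett–Manolescu's standing hypotheses,
without bounded angles and without the square-grid property). -/
def IsRegularFamily (G' : ℝ → SimpleGraph V') (emb' : (δ : ℝ) → RhombicEmbedding (G' δ) F') :
    Prop :=
  ∀ δ, (G' δ).Preconnected ∧ (emb' δ).IsIsoradial ∧ (emb' δ).IsRhombicTiling ∧ IsEdgeToEdge (emb' δ)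

/-- SECTORWISE RECTANGULAR ON THE WINDOW: at every mesh `δ ∈ (0, 1)`, two bulk rhombi of `Ω`
(`IsBulk`) that touch have the same side pair, i.e. are translates of one another. With
`IsRegularFamily` and `HasDirections u` this makes every connected bulk region a patch of ONE
rotated isoradial rectangular lattice `w · 𝕃(α) + c` at mesh `δ` (`α` one of the three angles
between the fixed directions), the "frozen block" of the cards. -/
def IsSectorwiseOn (Ω : Set ℂ) (S : Set (ℂ × ℂ)) (ϖ : ℝ → ℝ) (G' : ℝ → SimpleGraph V')
    (emb' : (δ : ℝ) → RhombicEmbedding (G' δ) F') : Prop :=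
  ∀ δ ∈ Set.Ioo (0 : ℝ) 1, ∀ d d' : (G' δ).Dart, IsBulk Ω S ϖ (emb' δ) δ d → IsBulk Ω S ϖ (emb' δ) δ d' →
    ((emb' δ).rhombus ⟨d.edge, d.edge_mem⟩ ∩ (emb' δ).rhombus ⟨d'.edge, d'.edge_mem⟩).Nonempty →
    sidePair (emb' δ) d = sidePair (emb' δ) d'

/-- SCHRAMM–SMIRNOV ASSUMPTIONS 1.1 for a mesh-indexed family, uniformly in the mesh — verbatim
the two hypotheses the route crux `GluingComparison` puts on each of its two models
(arXiv:1101.5820, Assumptions 1.1; four-arm event in the form of arXiv:2008.01606): (1) uniform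
box-crossing bounds at aspect ratio `2` (`BoxCrossingBounds`, lattice units, all translations);
(2) an alternating four-arm bound `P[twoClustersCross(w; m, n)] ≤ (m/n) · Δ(mδ, nδ)` for
`1 ≤ m < n`, `nδ < R₀`, with `Δ(r, ρ) → 0` as `r → 0⁺` for each `ρ ∈ (0, R₀)`. -/
def SSAssumptions (G' : ℝ → SimpleGraph V') (emb' : (δ : ℝ) → RhombicEmbedding (G' δ) F') : Prop :=
  (∃ c > (0 : ℝ), ∃ n₀ : ℕ, ∀ δ ∈ Set.Ioo (0 : ℝ) 1,
      BoxCrossingBounds (emb' δ).isoradialPercolation (emb' δ).z 2 c n₀) ∧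
  (∃ R₀ > (0 : ℝ), ∃ Δ : ℝ → ℝ → ℝ,
      (∀ ρ ∈ Set.Ioo (0 : ℝ) R₀, Tendsto (fun r ↦ Δ r ρ) (𝓝[>] 0) (𝓝 0)) ∧
      ∀ δ ∈ Set.Ioo (0 : ℝ) 1, ∀ (w : ℂ) (m n : ℕ), 1 ≤ m → m < n → (n : ℝ) * δ < R₀ →
        (emb' δ).isoradialPercolation.real (twoClustersCross (emb' δ) w m n) ≤
          (m / n : ℝ) * Δ (m * δ) (n * δ))

/-- COUPLED TO BOND-`ℤ²` ON THE WINDOW OFF THE SEAMS: mesh by mesh a coupling `P δ` of the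
family's canonical measure with `P_{1/2}` on `ℤ²` (exact marginals) under which, for every
conformal rectangle `R'` whose closure lies in `Ω ∖ ⋃ S`, the crude crossing indicators of `R'`
at mesh `δ` (family drawn by `(emb' δ).z`, `ℤ²` by `squareLatticeEmbedding.z`) agree with
probability `→ 1` as `δ → 0⁺` (the coupling clause of `GluingComparison`, localised to `Ω` and
with model 2 = `ℤ²`). -/
def CoupledToSquareOn (Ω : Set ℂ) (S : Set (ℂ × ℂ)) (G' : ℝ → SimpleGraph V')
    (emb' : (δ : ℝ) → RhombicEmbedding (G' δ) F') : Prop :=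
  ∃ P : ℝ → Measure (BondConfig V' × BondConfig (Site 2)),
    (∀ δ, (P δ).map Prod.fst = (emb' δ).isoradialPercolation ∧
      (P δ).map Prod.snd = bondPercolation (zdGraph 2) half) ∧
    ∀ R' : ConformalRectangle, closure R'.carrier ⊆ Ω \ seams S →
      Tendsto (fun δ ↦ (P δ).real {q | ¬ (q.1 ∈ embDomainCrossing (emb' δ).z R'.carrier δ (R'.arc 0) (R'.arc 2) ↔
        q.2 ∈ embDomainCrossing squareLatticeEmbedding.z R'.carrier δ (R'.arc 0) (R'.arc 2))})
        (𝓝[>] 0) (𝓝 0)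

end Families

/-! ### Stub signatures
`Sig.<stub>` is literally the statement of `<stub>`. -/

/-- Signature of `stub_windowRetiling`: every `G` as in the crux is, window by window,
crossing-equivalent to a regular, three-direction, sectorwise-rectangular block family satisfying
Schramm–Smirnov's Assumptions 1.1. The hypotheses on `(V, F, G, emb, ε)` are those of
`WindowTransport3`, verbatim. -/
def Sig.stub_windowRetiling : Prop :=
  ∀ (V F : Type) [Countable V] [DecidableEq V] [DecidableEq F] (G : SimpleGraph V) [G.LocallyFinite]
    (emb : RhombicEmbedding G F), G.Preconnected → emb.IsIsoradial → emb.IsRhombicTiling →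
    emb.HasSquareGridProperty → ∀ ε : ℝ, 0 < ε → emb.HasBoundedAngles ε →
    (∃ u : Fin 3 → ℂ, ∀ d : G.Dart, ∃ i : Fin 3, emb.c (emb.leftFace d) - emb.z d.fst = u i ∨
      emb.c (emb.leftFace d) - emb.z d.fst = -(u i)) →
    (∃ (σ₁ σ₂ : G ≃g G) (t₁ t₂ : ℂ), t₁ ≠ 0 ∧ (t₂ / t₁).im ≠ 0 ∧ (∀ v, emb.z (σ₁ v) = emb.z v + t₁) ∧
      ∀ v, emb.z (σ₂ v) = emb.z v + t₂) →
    ∀ R : ConformalRectangle,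
    ∃ (V' F' : Type) (_ : Countable V') (_ : DecidableEq V') (_ : DecidableEq F')
      (G' : ℝ → SimpleGraph V') (emb' : (δ : ℝ) → RhombicEmbedding (G' δ) F')
      (S : Set (ℂ × ℂ)) (ϖ : ℝ → ℝ) (u : Fin 3 → ℂ),
      IsRegularFamily G' emb' ∧ (∀ δ, HasDirections u (emb' δ)) ∧ Tendsto ϖ (𝓝[>] 0) (𝓝 0) ∧
      SeamsLocallyFinite R.carrier S ∧ IsSectorwiseOn R.carrier S ϖ G' emb' ∧ SSAssumptions G' emb' ∧
      Tendsto (fun δ ↦ emb.isoradialPercolation.real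
          (embDomainCrossing emb.z R.carrier δ (R.arc 0) (R.arc 2)) -
        (emb' δ).isoradialPercolation.real
          (embDomainCrossing (emb' δ).z R.carrier δ (R.arc 0) (R.arc 2))) (𝓝[>] 0) (𝓝 0)

/-- Signature of `stub_blockCoupling`: a regular three-direction family that is sectorwise
rectangular on the window `R.carrier` off the seams `S` (collar width `ϖ δ → 0`) is coupled to
bond-`ℤ²` on the window off the seams. -/
def Sig.stub_blockCoupling : Prop :=
  ∀ (V' F' : Type) [Countable V'] [DecidableEq V'] [DecidableEq F'] (G' : ℝ → SimpleGraph V')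
    (emb' : (δ : ℝ) → RhombicEmbedding (G' δ) F') (R : ConformalRectangle) (S : Set (ℂ × ℂ))
    (ϖ : ℝ → ℝ) (u : Fin 3 → ℂ),
    IsRegularFamily G' emb' → (∀ δ, HasDirections u (emb' δ)) → Tendsto ϖ (𝓝[>] 0) (𝓝 0) →
    SeamsLocallyFinite R.carrier S → IsSectorwiseOn R.carrier S ϖ G' emb' →
    CoupledToSquareOn R.carrier S G' emb'

/-- Signature of `stub_windowGluing`: a regular family satisfying Schramm–Smirnov's Assumptions
1.1 and coupled to bond-`ℤ²` on the window `R.carrier` off a locally finite family of seam segments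
has the same asymptotic crude crossing probability of `R` as bond-`ℤ²`. -/
def Sig.stub_windowGluing : Prop :=
  ∀ (V' F' : Type) [Countable V'] [DecidableEq V'] [DecidableEq F'] (G' : ℝ → SimpleGraph V')
    (emb' : (δ : ℝ) → RhombicEmbedding (G' δ) F') (R : ConformalRectangle) (S : Set (ℂ × ℂ)),
    IsRegularFamily G' emb' → SSAssumptions G' emb' → SeamsLocallyFinite R.carrier S →
    CoupledToSquareOn R.carrier S G' emb' →
    Tendsto (fun δ ↦ (emb' δ).isoradialPercolation.real
        (embDomainCrossing (emb' δ).z R.carrier δ (R.arc 0) (R.arc 2)) -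
      (bondPercolation (zdGraph 2) half).real
        (embDomainCrossing squareLatticeEmbedding.z R.carrier δ (R.arc 0) (R.arc 2))) (𝓝[>] 0) (𝓝 0)

/-! ### The stubs -/

/-- **STUB 1 — exact retiling of the window into frozen blocks** (cards
zero-error-star-triangle-gluing M1–M3; route items `ExactRetiling` (stmt-11312), `TrackCutCells`
(stmt-7657), `RowLawIdentity` (stmt-7656); a-priori bounds from Grimmett–Manolescu).
For every `G` as in the crux (bi-periodic, three side directions, GM class) and every conformal
rectangle `R` there is a mesh-indexed block family `B_δ` — regular (`IsRegularFamily`), with three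
FIXED side directions `u` (`HasDirections`), sectorwise rectangular on `Ω = R.carrier` off a seam set
`S` locally finite in `Ω` (`SeamsLocallyFinite`) and a collar of width `ϖ δ → 0` (`IsSectorwiseOn`),
satisfying Schramm–Smirnov's
Assumptions 1.1 uniformly in `δ` (`SSAssumptions`) — with
`P_G[crude crossing of R, δ] − P_{B_δ}[crude crossing of R, δ] → 0`.
Why plausibly true (intended witness, item `TrackCutCells`): cut `Ω` into track-cut cells of `G` —
cells bounded by train tracks of the three direction classes chosen `O(δ)`-close to fixed segments
(bi-periodic tracks are periodic zigzags of bounded width), of macroscopic size in the bulk and of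
Whitney type towards `∂Ω` (size comparable to the distance from `∂Ω`, down to the collar width
`ϖ δ ≫ δ`), so that the limiting seam segments `S` are locally finite in `Ω`; every cell is a
lozenge-tiled polygon whose sides are two-letter staircases and admits a frozen tiling by `O(1)`
two-direction blocks with the SAME boundary (de Bruijn height functions; flip connectivity, Thurston
1990, doi:10.2307/2324578); `B_δ := G` outside the retiled cells (in particular outside `Ω` and in
the collar), frozen blocks inside. `ExactRetiling` cell by cell (flip = star–triangle move, tree engine
`prodBernoulli_eq_of_isStarTriangleRelated`, arXiv:1105.5535 Prop. 2.2; cells are edge-disjoint, hence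
independent) makes the joint law of the cell-boundary-to-cell-boundary connection events IDENTICAL
for `G` and `B_δ` at every mesh, and the configuration off the retiled cells is literally shared; the
crude crossing event of `R` is determined by these data up to re-routing the first and last `O(ϖ δ)`
of a crossing near the arcs (microscopic boundary fuzz, from RSW; Schramm–Smirnov arXiv:1101.5820
App. A). RSW for `G`:
GM 2014 Thm 1.1 (arXiv:1204.0505), a bi-periodic three-direction tiling having the printed
square-grid property; RSW / four-arm bounds inside blocks and across two-phase seams: DKKMO
(arXiv:2012.11672) and GM 2013 arm comparability + van den Berg–Nolin `α₄ > 1` (arXiv:2008.01606).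
Why it might fail: a general Jordan `∂Ω` forces a three-direction COLLAR between the zigzag `∂K_δ`
and the blocks (allowed here only inside the `ϖ δ`-collar), and RSW / the four-arm bound must hold
UNIFORMLY at seam junctions and in that collar (no printed statement; SGP(I) fails for frozen blocks,
so GM's theorems do not apply verbatim); the boundary fuzz needs RSW of `G`, i.e. printed SGP for
bi-periodic three-direction graphs (the crux only carries the H21 rendering `HasSquareGridProperty`).
Size L–XL. Leans on: `ExactRetiling`, `prodBernoulli_eq_of_isStarTriangleRelated`,
`gm_boxCrossingBounds_uniform` / item `IsoradialBoxCrossing`, `BoxCrossingBounds.sub_const`;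
arXiv:1105.5535, arXiv:1204.0505, arXiv:2012.11672, arXiv:2008.01606, arXiv:1101.5820,
doi:10.2307/2324578. -/
theorem stub_windowRetiling : Sig.stub_windowRetiling := by
  sorry

/-- **STUB 2 — DKKMO coupling, sectorwise** (route item `IsoRectCrossingCoupling`, stmt-8437 =
arXiv:2012.11672 Thm 1.7 + Thm 1.2 at `q = 1` in crossing form).
A regular three-direction family that is sectorwise rectangular on `Ω` off the seams `S` (collar
`ϖ δ → 0`) admits couplings `P δ` with bond-`ℤ²` at `1/2` (exact marginals) under which, for every
conformal rectangle `R'` with `closure R' ⊆ Ω ∖ ⋃ S`, the crude crossing indicators of `R'` agree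
with probability `→ 1`.
Why plausibly true: `closure R'` is compact, connected and at positive distance from `∂Ω ∪ ⋃ S`, so
for small `δ` all rhombi meeting a neighbourhood of it are bulk and chain-connected, hence (touching
bulk rhombi being translates, edge-to-edge, three fixed directions) a patch of ONE rotated rectangular
lattice `w · δ𝕃(α) + c(δ)` with its canonical weights = `isoRectPercolation α` unfolded — exactly the
model of `IsoRectCrossingCoupling`, which supplies a coupling with `ℤ²` for every `(α, w, c(·))` making
all crude crossings agree w.h.p.; at most three lattice types occur (pairs of the fixed directions),
so a mesh-wise selection among three DKKMO couplings, restricted to the bulk components and filled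
in independently elsewhere (both models are product measures), has the right marginals.
Why it might fail: only as a formalisation — identifying a bulk patch of an abstract tiling on `V'`
with a sub-lattice of `zdGraph 2` and transporting events / product measures along it is heavy
(the crude event of `R'` must be shown to depend only on bulk edges for small `δ`); mathematically it
is DKKMO's theorem plus bookkeeping. Size L (formalisation), theorem in print.
Leans on: item `IsoRectCrossingCoupling` (stmt-8437), `isoRectPercolation`, `prodBernoulli`,
`Measure.map`, `IsRhombicTiling`; arXiv:2012.11672. -/
theorem stub_blockCoupling : Sig.stub_blockCoupling := by
  sorry

/-- **STUB 3 — two-model gluing at a window** (route crux `GluingComparison`, stmt-7030 =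
Schramm–Smirnov's Question 2 in two-model form, LOCALISED to one window; the heart of the line).
A regular family `B_δ` satisfying Schramm–Smirnov's Assumptions 1.1 uniformly in `δ`, coupled to
bond-`ℤ²` on the window `Ω = R.carrier` off a family of seam segments `S` locally finite in `Ω` (crude
crossings of every `R' ⋐ Ω ∖ ⋃ S` agree w.h.p.), satisfies `P_{B_δ}[crude crossing of R, δ] − P_ℤ²[crude crossing of
R, δ] → 0` for the window `R` ITSELF (whose arcs lie on `∂Ω` and which straddles the seams).
Why plausibly true: Schramm–Smirnov's factorisation (arXiv:1101.5820 Thm 1.5/1.7, Prop. 4.1): the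
crossing event of a quad is measurable, up to events of small probability, with respect to the
crossing events of quads inside the pieces of a finite smooth decomposition, the defect being
controlled by four-arm events ON the seams (Assumption 1.1(2): expected number of `δ`-pivotal seam
points `→ 0`) and three-arm events at `∂Ω` (App. A / Lemma 6.1 boundary fuzz, from RSW); run for the
two coupled models at once, the approximating events agree w.h.p. by the coupling, so the two
crossing probabilities of `R` are asymptotically equal. On the `ℤ²` side RSW and `α₄ > 1` are in the
tree (`RSWProofs`, `FourArmGarban*`).
Why it might fail: SS's gluing is NON-CONSTRUCTIVE (Remark 3; Question 2 open since 2011;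
Khristoforov 2018 Thm II.3 picks the gluing map by variance minimisation under a scaling limit that is
not available here) — a mesh- and model-independent approximation rule must show that multi-hop /
near-miss passages of the seams are four-arm points on the seam; for a general Jordan `∂Ω` the
boundary fuzz at the arcs' ends is beyond SS's three perturbation types. Size: open problem (= the
route's rank-2 crux, window-local form). Leans on: `GluingComparison` (pattern), tree modules
`QuadCrossingContinuity*`, `QuadCrossingDiscreteGluing*`, `GluingStructure`, `SchrammSmirnov2011_lemma_6_1`;
arXiv:1101.5820, doi:10.13097/archive-ouverte/unige:111513, arXiv:2008.01606. -/
theorem stub_windowGluing : Sig.stub_windowGluing := by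
  sorry

/-! ### The composition (sorry-free): the three stub statements give the crux BY NAME -/

/-- **The line closes the crux.** Hypotheses: the three stub statements; conclusion: literally the
route decl `CardyRetileGlue.WindowTransport3`. Fix `(V, F, G, emb)` with the crux's hypotheses and a
conformal rectangle `R`; `stub_windowRetiling` yields the block family `B` with
`P_G(R, δ) − P_B(R, δ) → 0`; `stub_blockCoupling` couples `B` to `ℤ²` on the window off the seams;
`stub_windowGluing` turns the coupling and the a-priori bounds into `P_B(R, δ) − P_ℤ²(R, δ) → 0`;
the sum of the two limits is the claim (`sub_add_sub_cancel`). -/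
theorem WindowTransport3_of :
    Sig.stub_windowRetiling → Sig.stub_blockCoupling → Sig.stub_windowGluing →
      Summit.CriticalPhenomena.CardyFormulaZ2.Theses.CardyRetileGlue.WindowTransport3 := by
  intro h1 h2 h3 V F hcV hdV hdF G hLF emb hpre hiso htile hsgp ε hε hbap hdir hper R
  -- the block family of the window, with its structure, a-priori bounds and `P_G - P_B → 0`
  obtain ⟨V', F', hcV', hdV', hdF', G', emb', S, ϖ, u, hreg, hdir', hϖ, hfin, hsect, hSS, hlim⟩ :=
    h1 V F G emb hpre hiso htile hsgp ε hε hbap hdir hper R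
  -- DKKMO sectorwise: the block family is coupled to `ℤ²` on the window off the seams
  have hcpl : CoupledToSquareOn R.carrier S G' emb' :=
    h2 V' F' G' emb' R S ϖ u hreg hdir' hϖ hfin hsect
  -- two-model gluing at the window: `P_B - P_ℤ² → 0`
  have hglue := h3 V' F' G' emb' R S hreg hSS hfin hcpl
  -- telescope
  have h := hlim.add hglue
  simp only [sub_add_sub_cancel, add_zero] at h
  exact h

/-- The crux from the three registered stubs, used BY NAME (its only unproved dependencies are
`stub_windowRetiling`, `stub_blockCoupling`, `stub_windowGluing`). -/
theorem WindowTransport3_of_stubs :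
    Summit.CriticalPhenomena.CardyFormulaZ2.Theses.CardyRetileGlue.WindowTransport3 :=
  WindowTransport3_of stub_windowRetiling stub_blockCoupling stub_windowGluing

end Summit.CriticalPhenomena.CardyFormulaZ2.Cruxes.WindowTransport3.Birth
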